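import Summits.NavierStokesRegularity.NavierStokesRegularity.Theorems.StrainDoorsSliceConcentrationCriterion
import Literature.Analysis.FluidPDE.BarkerPrangeConcentrationHolds
import Literature.Analysis.FluidPDE.NSSereginEnergyApproximants
import HarnessLib

/-!
# Strain doors, PART M §M27 — Barker–Prange's Theorem 3 with a FIXED `δ₀` along a sequence of times,
# UNCONDITIONALLY for solutions which are Type I in both the sup-norm and the `L²`-Morrey sense

ROUND 68 of the `ns-regularity-ideate` p1 line (helper lane of `stmt-NavierStokesRegularity-0056`, rung N0;
nothing here is a claim about Navier–Stokes regularity — Type-I singular points are excluded under a direction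
hypothesis; nothing about Type II).

* §M27(a) `isRegularPoint_of_classical`: every point of the open strip of a classical solution on `[0,T)` is
  regular; `pow_three_lt_integral_of_ofReal_lt_eLpNorm`: `γ < ‖f‖_{L³(B̄)}` (as `eLpNorm`) gives
  `γ³ < ∫_{B̄} |f|³` for continuous `f`.
* §M27(b) ★★★ `l3_concentration_of_morreyTypeI_local` (PROVED): Barker–Prange 2020 (ARMA) Theorem 2 — `L³`
  concentration `‖u(t)‖_{L³(B̄(x₀, 2√(ν(T−t)/S(M))))} > γν` at EVERY `t ∈ (0,T)` at a singular point `(T,x₀)` —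
  for Leray–Hopf solutions on `[0,T)` (the tree's named fact `BarkerPrange2020_thm2` is stated for GLOBAL
  Leray–Hopf solutions), regular on the open strip, under the Morrey-type Type-I bound
  `‖u(t)‖_{L²(B_r(x̄))} ≤ Mν√r` (`T − r²/ν < t < T`, all radii).  Proof = the tree's printed §4.2 argument
  (`BarkerPrange2020_thm2_of_localizedSmoothing`) verbatim, over the PROVED slab form of Theorem 1
  (`BarkerPrange2020_thm1_slab`) and the tree's restart theorem for `[0,T)`
  (`IsLerayHopfOn.exists_isLocalEnergySolutionOn_restart`).
* §M27(c) ★★★★ `sliceAligned_fixedDelta_not_singular_of_morreyTypeI` (PROVED, unconditional): for `M`,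
  `M₂ > 0`, `R > 0` there is `δ₀ = δ₀(M,M₂,R) > 0` such that a classical solution on `ℝ³ × [0,T)`, Leray–Hopf on
  `[0,T)`, with `|u| ≤ M/√(T − t)` AND `‖u(t)‖_{L²(B_r(x̄))} ≤ M₂√r` for `T − r² < t < T`, whose vorticity
  directions satisfy `|ξ(x,s_n) − ξ(y,s_n)| ≤ δ₀` on `B(x₀,R√(T − s_n)) ∩ {|ω| > d}` along SOME sequence
  `s_n → T`, is not singular at `(T,x₀)`: Barker–Prange's Theorem 3 with the modulus `η` replaced by a FIXED
  `δ₀`, at the price of the second (Morrey-type) Type-I hypothesis of their concentration theorem.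

Honest status: the Morrey-type bound follows from the sup-norm Type-I bound only with a SOLUTION-DEPENDENT
constant (Barker–Prange 2020 p. 5, after Seregin–Zajączkowski), so `δ₀` here depends on the two Type-I
constants, not on `M` alone (that would be §M26's door X).  `δ₀` is ineffective.

References: Barker–Prange, Arch. Ration. Mech. Anal. 236 (2020) 1487–1541 (arXiv:1812.09115) Thm 2, §4.2;
Barker–Prange, arXiv:1906.08225, Thm 3; Kang–Miura–Tsai, IMRN 2021, Thm 1.1; Seregin, CMP 312 (2012) §3;
Giga–Miura, Comm. Math. Phys. 303 (2011) Thm 1.1.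
-/

noncomputable section

-- the summit and its single problem share the name `NavierStokesRegularity` (D-0017 nested layout)
set_option linter.dupNamespace false

open MeasureTheory Set Function Filter Metric Real InnerProductSpace
open _root_.Topology
open scoped ENNReal NNReal RealInnerProductSpace
open Literature.Analysis Literature.Analysis.FluidPDE Literature.Analysis.FluidPDE.LocalTypeIBlowup

namespace Summit.NavierStokesRegularity.NavierStokesRegularity.Theorems.StrainDoors

/-! ### §M27(a) Regular points of classical solutions; `eLpNorm`-to-integral conversion -/

/-- Every point `(t,x)`, `0 < t < T`, of a classical solution on `[0,T)` is a regular point (the velocity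
is continuous, hence bounded on a compact centred cylinder inside the strip). [folklore] -/
theorem isRegularPoint_of_classical {T : ℝ}
    {u : ℝ → EuclideanSpace ℝ (Fin 3) → EuclideanSpace ℝ (Fin 3)} {p : ℝ → EuclideanSpace ℝ (Fin 3) → ℝ}
    (hcl : IsClassicalNSSolutionOn (Ico 0 T) 1 0 u p) {t : ℝ} (ht : t ∈ Ioo 0 T)
    (x : EuclideanSpace ℝ (Fin 3)) : IsRegularPoint u (t, x) := by
  set m : ℝ := min t (T - t) with hm
  have hmpos : 0 < m := lt_min ht.1 (by linarith [ht.2])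
  set r : ℝ := Real.sqrt (m / 2) with hr
  have hrpos : 0 < r := Real.sqrt_pos.2 (by positivity)
  have hr2 : r ^ 2 = m / 2 := by rw [hr, Real.sq_sqrt (by positivity)]
  have h1 : r ^ 2 < t := by rw [hr2]; linarith [min_le_left t (T - t)]
  have h2 : t + r ^ 2 < T := by rw [hr2]; linarith [min_le_right t (T - t)]
  refine ⟨r, hrpos, ?_⟩
  have hK : IsCompact (Icc (t - r ^ 2) (t + r ^ 2) ×ˢ closedBall x r) :=
    isCompact_Icc.prod (isCompact_closedBall x r)
  have hKsub : Icc (t - r ^ 2) (t + r ^ 2) ×ˢ closedBall x r ⊆ Ico 0 T ×ˢ (univ : Set (EuclideanSpace ℝ (Fin 3))) :=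
    fun z hz => ⟨⟨by linarith [hz.1.1], by linarith [hz.1.2]⟩, mem_univ _⟩
  have hcont : ContinuousOn (uncurry u) (Icc (t - r ^ 2) (t + r ^ 2) ×ˢ closedBall x r) :=
    hcl.smooth_velocity.continuousOn.mono hKsub
  obtain ⟨C, hC⟩ := hK.exists_bound_of_continuousOn hcont
  have hsub : parabolicCylinderCentered r ((t, x) : ℝ × EuclideanSpace ℝ (Fin 3)) ⊆
      Icc (t - r ^ 2) (t + r ^ 2) ×ˢ closedBall x r := by
    intro z hz
    rw [parabolicCylinderCentered, mem_prod] at hz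
    exact ⟨⟨hz.1.1.le, hz.1.2.le⟩, ball_subset_closedBall hz.2⟩
  have hmeas : MeasurableSet (parabolicCylinderCentered r ((t, x) : ℝ × EuclideanSpace ℝ (Fin 3))) := by
    rw [parabolicCylinderCentered]; exact measurableSet_Ioo.prod measurableSet_ball
  have hbound : ∀ᵐ z ∂(volume.restrict (parabolicCylinderCentered r ((t, x) : ℝ × EuclideanSpace ℝ (Fin 3)))),
      ‖uncurry u z‖ ≤ C :=
    (ae_restrict_iff' hmeas).2 (Eventually.of_forall fun z hz => hC z (hsub hz))
  rw [eLpNorm_exponent_top]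
  exact eLpNormEssSup_lt_top_of_ae_bound hbound

/-- `ofReal γ < ‖f‖_{L³(B̄(c,ρ))}` (Mathlib `eLpNorm`) gives `γ³ < ∫_{B̄(c,ρ)} |f|³` for continuous `f` and
`γ ≥ 0`. [folklore] -/
theorem pow_three_lt_integral_of_ofReal_lt_eLpNorm
    {f : EuclideanSpace ℝ (Fin 3) → EuclideanSpace ℝ (Fin 3)} (hf : Continuous f) {γ : ℝ} (hγ : 0 ≤ γ)
    (c : EuclideanSpace ℝ (Fin 3)) (ρ : ℝ)
    (h : ENNReal.ofReal γ < eLpNorm f 3 (volume.restrict (closedBall c ρ))) :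
    γ ^ 3 < ∫ x in closedBall c ρ, ‖f x‖ ^ 3 := by
  rw [eLpNorm_eq_lintegral_rpow_enorm_toReal (by norm_num) (by norm_num)] at h
  have h3 : (3 : ℝ≥0∞).toReal = 3 := by norm_num
  rw [h3] at h
  have h' : ENNReal.ofReal γ ^ (3 : ℝ) < ∫⁻ x in closedBall c ρ, ‖f x‖ₑ ^ (3 : ℝ) := by
    have h1 := ENNReal.rpow_lt_rpow h (by norm_num : (0 : ℝ) < 3)
    rwa [← ENNReal.rpow_mul, show (1 / (3 : ℝ)) * 3 = 1 by norm_num, ENNReal.rpow_one] at h1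
  have hint : IntegrableOn (fun x => ‖f x‖ ^ 3) (closedBall c ρ) volume :=
    (hf.norm.pow 3).continuousOn.integrableOn_compact (isCompact_closedBall c ρ)
  have heq : ∫⁻ x in closedBall c ρ, ‖f x‖ₑ ^ (3 : ℝ) = ENNReal.ofReal (∫ x in closedBall c ρ, ‖f x‖ ^ 3) := by
    rw [ofReal_integral_eq_lintegral_ofReal hint (Eventually.of_forall fun x => pow_nonneg (norm_nonneg _) 3)]
    refine lintegral_congr fun x => ?_
    rw [← ofReal_norm, ENNReal.ofReal_rpow_of_nonneg (norm_nonneg _) (by norm_num)]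
    congr 1
    exact_mod_cast Real.rpow_natCast ‖f x‖ 3
  have hγ3 : ENNReal.ofReal γ ^ (3 : ℝ) = ENNReal.ofReal (γ ^ 3) := by
    rw [ENNReal.ofReal_rpow_of_nonneg hγ (by norm_num)]
    congr 1
    exact_mod_cast Real.rpow_natCast γ 3
  rw [hγ3, heq] at h'
  exact (ENNReal.ofReal_lt_ofReal_iff'.1 h').1

/-! ### §M27(b) Barker–Prange 2020, Theorem 2, for Leray–Hopf solutions on `[0,T)` -/

/-- ★★★ **BARKER–PRANGE 2020, THEOREM 2, LOCAL-IN-TIME LERAY–HOPF CLASS** (`L³` concentration at the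
similarity scale near a Type-I singularity): there are a universal `γ > 0` and, for every `M > 0`, a time
`S = S(M) ∈ (0, ¼]` such that for every viscosity `ν > 0` and `T > 0`, every Leray–Hopf weak solution `u`
of the unforced Navier–Stokes equations on `ℝ³ × [0,T)` (`IsLerayHopfOn T ν 0 u₀ u`) with the Morrey-type
Type-I bound `‖u(t)‖_{L²(B_r(x̄))} ≤ M ν √r` for all `x̄`, `r > 0`, `T − r²/ν < t < T`, all of whose points in
the open strip `0 < t < T` are regular, and every singular point `(T,x₀)` (`u` essentially unbounded on the
backward cylinders `(T − r², T) × B_r(x₀)`, `r² < T`): for every `t ∈ (0,T)`,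
`‖u(t)‖_{L³(B̄(x₀, 2√(ν(T − t)/S)))} > γν`.  The tree's `BarkerPrange2020_thm2_holds` is this for GLOBAL
Leray–Hopf solutions (and a radius cap `r₀`); the proof below is the tree's
`BarkerPrange2020_thm2_of_localizedSmoothing`, verbatim, fed with `BarkerPrange2020_thm1_slab` and the `[0,T)`
restart theorem `IsLerayHopfOn.exists_isLocalEnergySolutionOn_restart`.
[cite: BarkerPrange2020, Thm 2 with §4.2 and Thm 1 (arXiv:1812.09115 pp. 2, 4–5, 16);
KangMiuraTsai2020, Thm 1.1; Seregin2012CMP, §3] -/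
theorem l3_concentration_of_morreyTypeI_local :
    ∃ γ : ℝ, 0 < γ ∧ ∀ M : ℝ, 0 < M → ∃ S : ℝ, 0 < S ∧ S ≤ 1 / 4 ∧
      ∀ (ν T : ℝ), 0 < ν → 0 < T →
      ∀ (u₀ : EuclideanSpace ℝ (Fin 3) → EuclideanSpace ℝ (Fin 3))
        (u : ℝ → EuclideanSpace ℝ (Fin 3) → EuclideanSpace ℝ (Fin 3)), IsLerayHopfOn T ν 0 u₀ u →
        (∀ (y : EuclideanSpace ℝ (Fin 3)) (r : ℝ), 0 < r → ∀ t : ℝ, 0 < t → T - r ^ 2 / ν < t → t < T →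
            eLpNorm (u t) 2 (volume.restrict (ball y r)) ≤ ENNReal.ofReal (M * ν * Real.sqrt r)) →
        (∀ t ∈ Ioo 0 T, ∀ x : EuclideanSpace ℝ (Fin 3), IsRegularPoint u (t, x)) →
        ∀ x₀ : EuclideanSpace ℝ (Fin 3),
          (∀ r : ℝ, 0 < r → r ^ 2 < T →
            eLpNorm (uncurry u) ⊤ (volume.restrict (parabolicCylinder r ((T : ℝ), x₀))) = ⊤) →
          ∀ t ∈ Ioo 0 T, ENNReal.ofReal (γ * ν) <
            eLpNorm (u t) 3 (volume.restrict (closedBall x₀ (2 * Real.sqrt (ν * (T - t) / S)))) := by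
  obtain ⟨γ, hγ, hT1⟩ := BarkerPrange2020_thm1_slab
  refine ⟨γ, hγ, fun M hM => ?_⟩
  obtain ⟨S, hS, hS4, hsm⟩ := hT1 M hM
  refine ⟨S, hS, hS4, fun ν T hν hT => ?_⟩
  have hS1 : S < 1 := by linarith
  intro u₀ u hLH hTypeI hReg x₀ hSing t ht
  have ht0 : 0 < t := ht.1
  have htT : t < T := ht.2
  have hTt : 0 < T - t := sub_pos.2 htT
  by_contra hcon
  rw [not_lt] at hcon
  -- the similarity scale `λ`, `λ² = ν (T - t) / S`
  have hpos : 0 < ν * (T - t) / S := div_pos (mul_pos hν hTt) hS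
  obtain ⟨l, hl_def, hl, hl2⟩ :
      ∃ l : ℝ, l = Real.sqrt (ν * (T - t) / S) ∧ 0 < l ∧ l ^ 2 = ν * (T - t) / S :=
    ⟨_, rfl, Real.sqrt_pos.2 hpos, Real.sq_sqrt hpos.le⟩
  rw [← hl_def] at hcon
  have hν0 : ν ≠ 0 := hν.ne'
  have hS0 : S ≠ 0 := hS.ne'
  have hl0 : l ≠ 0 := hl.ne'
  have hTt0 : T - t ≠ 0 := hTt.ne'
  have hβ : 0 < l ^ 2 / ν := by positivity
  have hl2ν : l ^ 2 / ν = (T - t) / S := by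
    rw [hl2]; field_simp
  -- the time window of the Type-I bound at radius `λ`: `T - λ²/ν < t` since `S < 1`
  have hwin : T - l ^ 2 / ν < t := by
    rw [hl2ν]
    have h1 : (T - t) * S < T - t := mul_lt_of_lt_one_right hTt hS1
    have h2 : T - t < (T - t) / S := (lt_div_iff₀ hS).2 h1
    linarith
  -- the restarted solution, and the rescaled local energy solution of §4.2
  obtain ⟨pr, hpr⟩ := hLH.exists_isLocalEnergySolutionOn_restart hν hT hReg ⟨ht0, htT⟩
  have hβeq : l ^ 2 / ν = l / ν * l := by
    rw [sq]; ring
  have hv := hpr.stRescale (div_pos hl hν) hl hβeq x₀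
  have hslab : (T - t) / (l ^ 2 / ν) = S := by
    rw [hl2]; field_simp
  have hvisc : l / ν * ν / l = 1 := by
    field_simp
  have hfun : ((l / ν) • stPull (l ^ 2 / ν) l 0 x₀ fun s => u (t + s)) =
      (l / ν) • stPull (l ^ 2 / ν) l t x₀ u := by
    funext s y
    simp only [smul_stPull_apply, zero_add]
  rw [hslab, hvisc, hfun] at hv
  -- its datum: in `L²`, hence in `E²`
  have hut : MemLp (u t) 2 volume := hLH.memLp t ⟨ht0.le, htT.le⟩
  have hv₀2 : MemLp (fun y => (l / ν) • u t (x₀ + l • y)) 2 volume :=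
    (memLp_comp_add_smul hut x₀ hl).const_smul (l / ν)
  have hE2 : MemE2 (fun y => (l / ν) • u t (x₀ + l • y)) :=
    memE2_of_memLp hv₀2 le_rfl (by norm_num)
  have hsmul : ∀ q : ℝ≥0∞, ∀ μ : Measure (EuclideanSpace ℝ (Fin 3)),
      eLpNorm (fun y => (l / ν) • u t (x₀ + l • y)) q μ =
        ‖l / ν‖ₑ * eLpNorm (fun y => u t (x₀ + l • y)) q μ := fun q μ => by
    rw [show (fun y => (l / ν) • u t (x₀ + l • y)) = (l / ν) • fun y => u t (x₀ + l • y)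
      from rfl, eLpNorm_const_smul]
  have hlν : ‖l / ν‖ₑ = ENNReal.ofReal (l / ν) := Real.enorm_eq_ofReal (by positivity)
  -- `‖v₀‖_{L²(B₁(x̄))} ≤ M` from the Type-I bound at radius `λ`
  have hL2 : ∀ x₁ : (EuclideanSpace ℝ (Fin 3)), eLpNorm (fun y => (l / ν) • u t (x₀ + l • y)) 2
      (volume.restrict (ball x₁ 1)) ≤ ENNReal.ofReal M := by
    intro x₁
    have hTI := hTypeI (x₀ + l • x₁) l hl t ht0 hwin htT
    have hsl : l * Real.sqrt l = Real.sqrt l ^ 3 := by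
      calc l * Real.sqrt l = Real.sqrt l ^ 2 * Real.sqrt l := by rw [Real.sq_sqrt hl.le]
        _ = Real.sqrt l ^ 3 := by ring
    have hs0 : 0 < Real.sqrt l := Real.sqrt_pos.2 hl
    calc eLpNorm (fun y => (l / ν) • u t (x₀ + l • y)) 2 (volume.restrict (ball x₁ 1))
        = ‖l / ν‖ₑ * (ENNReal.ofReal ((l ^ 3)⁻¹) ^ (1 / (2 : ℝ≥0∞)).toReal *
            eLpNorm (u t) 2 (volume.restrict (ball (x₀ + l • x₁) (l * 1)))) := by
          rw [hsmul, eLpNorm_comp_add_smul_ball (u t) x₀ x₁ hl 1 (by norm_num)]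
      _ ≤ ‖l / ν‖ₑ * (ENNReal.ofReal ((Real.sqrt l ^ 3)⁻¹) *
            ENNReal.ofReal (M * ν * Real.sqrt l)) := by
          rw [ofReal_inv_cube_rpow_half hl, mul_one]
          gcongr
      _ = ENNReal.ofReal M := by
          rw [hlν, ← ENNReal.ofReal_mul (by positivity), ← ENNReal.ofReal_mul (by positivity)]
          congr 1
          rw [← hsl]
          field_simp
  -- `‖v₀‖_{L³(B₂(0))} ≤ γ` from the assumed smallness at time `t`
  have hL3 : eLpNorm (fun y => (l / ν) • u t (x₀ + l • y)) 3
      (volume.restrict (ball (0 : (EuclideanSpace ℝ (Fin 3))) 2)) ≤ ENNReal.ofReal γ := by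
    have h1 : eLpNorm (u t) 3 (volume.restrict (ball x₀ (2 * l))) ≤ ENNReal.ofReal (γ * ν) :=
      (eLpNorm_mono_measure _ (Measure.restrict_mono ball_subset_closedBall le_rfl)).trans hcon
    calc eLpNorm (fun y => (l / ν) • u t (x₀ + l • y)) 3 (volume.restrict (ball (0 : (EuclideanSpace ℝ (Fin 3))) 2))
        = ‖l / ν‖ₑ * (ENNReal.ofReal ((l ^ 3)⁻¹) ^ (1 / (3 : ℝ≥0∞)).toReal *
            eLpNorm (u t) 3 (volume.restrict (ball (x₀ + l • (0 : (EuclideanSpace ℝ (Fin 3)))) (l * 2)))) := by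
          rw [hsmul, eLpNorm_comp_add_smul_ball (u t) x₀ 0 hl 2 (by norm_num)]
      _ ≤ ‖l / ν‖ₑ * (ENNReal.ofReal l⁻¹ * ENNReal.ofReal (γ * ν)) := by
          rw [ofReal_inv_cube_rpow_third hl, smul_zero, add_zero, mul_comm l 2]
          gcongr
      _ = ENNReal.ofReal γ := by
          rw [hlν, ← ENNReal.ofReal_mul (by positivity), ← ENNReal.ofReal_mul (by positivity)]
          congr 1
          field_simp
  -- Theorem 1: the rescaled solution is bounded on `(S/2, S) × B_{1/3}(0)`
  have hbdd := hsm _ _ _ hv hE2 hL2 hL3 (S / 2) ⟨by linarith, by linarith⟩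
  -- back to `u`: bounded on `(t + (T - t)/2, T) × B_{λ/3}(x₀)`
  have hpre : stAffine (l ^ 2 / ν) l t x₀ ⁻¹' (Ioo (t + (T - t) / 2) T ×ˢ ball x₀ (l / 3)) =
      Ioo (S / 2) S ×ˢ ball (0 : (EuclideanSpace ℝ (Fin 3))) (1 / 3) := by
    rw [stAffine_preimage_cylinder hβ hl, hl2ν, sub_self, smul_zero]
    congr 1
    · congr 1
      · field_simp
        ring
      · field_simp
    · congr 1
      field_simp
  have hbdd' : eLpNorm (uncurry u) ⊤
      (volume.restrict (Ioo (t + (T - t) / 2) T ×ˢ ball x₀ (l / 3))) < ⊤ := by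
    rw [← hpre, eLpNorm_top_uncurry_smul_stPull_preimage hβ hl] at hbdd
    rcases ENNReal.mul_lt_top_iff.1 hbdd with (⟨-, h⟩ | h | h)
    · exact h
    · exact absurd h (by simp [hl0, hν0])
    · rw [h]; exact ENNReal.zero_lt_top
  -- a backward cylinder at `(T, x₀)` inside that box
  set r : ℝ := min (l / 3) (Real.sqrt ((T - t) / 2)) with hr_def
  have hr : 0 < r := lt_min (by positivity) (Real.sqrt_pos.2 (by positivity))
  have hr2 : r ^ 2 ≤ (T - t) / 2 := by
    have h1 : r ≤ Real.sqrt ((T - t) / 2) := min_le_right _ _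
    have h2 : r ^ 2 ≤ Real.sqrt ((T - t) / 2) ^ 2 := pow_le_pow_left₀ hr.le h1 2
    rwa [Real.sq_sqrt (by positivity)] at h2
  have hrT : r ^ 2 < T := by linarith
  have hsub : parabolicCylinder r ((T : ℝ), x₀) ⊆ Ioo (t + (T - t) / 2) T ×ˢ ball x₀ (l / 3) := by
    rintro ⟨s, y⟩ hz
    rw [mem_parabolicCylinder] at hz
    exact ⟨⟨by linarith [hz.1.1], hz.1.2⟩, mem_ball.2 (lt_of_lt_of_le hz.2 (min_le_left _ _))⟩
  have hlt : eLpNorm (uncurry u) ⊤ (volume.restrict (parabolicCylinder r ((T : ℝ), x₀))) < ⊤ :=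
    (eLpNorm_mono_measure _ (Measure.restrict_mono hsub le_rfl)).trans_lt hbdd'
  exact hlt.ne (hSing r hr hrT)

/-! ### §M27(c) The fixed-`δ₀` direction criterion along a sequence of times, two Type-I bounds -/

/-- ★★★★ **BARKER–PRANGE THEOREM 3 WITH A FIXED `δ₀` ALONG A SEQUENCE OF TIMES — UNCONDITIONAL FOR
SOLUTIONS WHICH ARE TYPE I IN THE SUP-NORM AND IN THE `L²`-MORREY SENSE.**  For `M`, `M₂ > 0` and `R > 0`
there is `δ₀ = δ₀(M,M₂,R) > 0` such that: if `(u,p)` is a classical solution of the unit-viscosity unforced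
Navier–Stokes system on `ℝ³ × [0,T)`, Leray–Hopf on `[0,T)`, with `|u(t,x)| ≤ M/√(T − t)` on `(0,T)` and
`‖u(t)‖_{L²(B_r(x̄))} ≤ M₂ √r` for all `x̄`, `r > 0`, `T − r² < t < T`, and if along SOME sequence of times
`s_n → T` in `(0,T)` the vorticity directions satisfy `|ξ(x,s_n) − ξ(y,s_n)| ≤ δ₀` for all
`x, y ∈ B(x₀, R√(T − s_n))` with `|ω(·,s_n)| > d` at both, then `(T,x₀)` is NOT a singular point.
Proof: `frequently_slice_smallMass_of_sliceAligned` at `(M, R, 2/√S(M₂), γ³)` against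
`l3_concentration_of_morreyTypeI_local` at one of the times `s_n`.
[cite: BarkerPrange2020Alignment, Thm 3 (arXiv:1906.08225 p. 18); BarkerPrange2020, Thm 2
(arXiv:1812.09115 pp. 4–5); GigaMiura2011, Thm 1.1] -/
theorem sliceAligned_fixedDelta_not_singular_of_morreyTypeI (M : ℝ) {M₂ : ℝ} (hM₂ : 0 < M₂) {R : ℝ}
    (hR : 0 < R) :
    ∃ δ₀ : ℝ, 0 < δ₀ ∧
      ∀ (T : ℝ) (u : ℝ → EuclideanSpace ℝ (Fin 3) → EuclideanSpace ℝ (Fin 3))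
        (p : ℝ → EuclideanSpace ℝ (Fin 3) → ℝ), 0 < T →
        IsClassicalNSSolutionOn (Ico 0 T) 1 0 u p → IsLerayHopfOn T 1 0 (u 0) u →
        (∀ t ∈ Ioo 0 T, ∀ x : EuclideanSpace ℝ (Fin 3), ‖u t x‖ ≤ M / Real.sqrt (T - t)) →
        (∀ (y : EuclideanSpace ℝ (Fin 3)) (r : ℝ), 0 < r → ∀ t : ℝ, 0 < t → T - r ^ 2 < t → t < T →
            eLpNorm (u t) 2 (volume.restrict (ball y r)) ≤ ENNReal.ofReal (M₂ * Real.sqrt r)) →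
        ∀ (x₀ : EuclideanSpace ℝ (Fin 3)) (d : ℝ) (s : ℕ → ℝ), (∀ n, s n ∈ Ioo 0 T) →
          Tendsto s atTop (𝓝 T) →
          (∀ (n : ℕ) (x y : EuclideanSpace ℝ (Fin 3)), x ∈ ball x₀ (R * Real.sqrt (T - s n)) →
            y ∈ ball x₀ (R * Real.sqrt (T - s n)) → d < ‖curl (u (s n)) x‖ → d < ‖curl (u (s n)) y‖ →
              ‖vorticityDirection (curl (u (s n))) x - vorticityDirection (curl (u (s n))) y‖ ≤ δ₀) →
          ¬ IsBackwardSingularPoint u (T, x₀) := by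
  obtain ⟨γ, hγ, hL⟩ := l3_concentration_of_morreyTypeI_local
  obtain ⟨S, hS, hS4, hconc⟩ := hL M₂ hM₂
  obtain ⟨δ₀, hδ₀, hcore⟩ :=
    frequently_slice_smallMass_of_sliceAligned M hR (by positivity : 0 < 2 / Real.sqrt S) (pow_pos hγ 3)
  refine ⟨δ₀, hδ₀, ?_⟩
  intro T u p hT hcl hLH hI hMor x₀ d s hs hsT hcoh hsing
  -- the hypotheses of the concentration theorem (`ν = 1`)
  have hReg : ∀ t ∈ Ioo 0 T, ∀ x : EuclideanSpace ℝ (Fin 3), IsRegularPoint u (t, x) :=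
    fun t ht x => isRegularPoint_of_classical hcl ht x
  have hTypeI : ∀ (y : EuclideanSpace ℝ (Fin 3)) (r : ℝ), 0 < r → ∀ t : ℝ, 0 < t → T - r ^ 2 / 1 < t →
      t < T → eLpNorm (u t) 2 (volume.restrict (ball y r)) ≤ ENNReal.ofReal (M₂ * 1 * Real.sqrt r) := by
    intro y r hr t ht0 hwin htT
    rw [mul_one]
    exact hMor y r hr t ht0 (by rwa [div_one] at hwin) htT
  have hSing : ∀ r : ℝ, 0 < r → r ^ 2 < T →
      eLpNorm (uncurry u) ⊤ (volume.restrict (parabolicCylinder r ((T : ℝ), x₀))) = ⊤ :=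
    fun r hr _ => hsing r hr
  -- a slice of small mass among the `s n`
  obtain ⟨n, -, hlt⟩ := hcore T u p hT hcl hLH hI x₀ d s hs hsT hcoh hsing 0
  -- concentration at that slice
  have hc := hconc 1 T one_pos hT (u 0) u hLH hTypeI hReg x₀ hSing (s n) (hs n)
  rw [mul_one, one_mul] at hc
  have hrad : 2 * Real.sqrt ((T - s n) / S) = 2 / Real.sqrt S * Real.sqrt (T - s n) := by
    rw [Real.sqrt_div (by linarith [(hs n).2] : 0 ≤ T - s n)]
    ring
  rw [hrad] at hc
  have hslice : Continuous (u (s n)) := by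
    have hc' : ContinuousOn (uncurry u) (Ico 0 T ×ˢ univ) := hcl.smooth_velocity.continuousOn
    exact hc'.comp_continuous (continuous_const.prodMk continuous_id)
      (fun x : EuclideanSpace ℝ (Fin 3) => (⟨⟨(hs n).1.le, (hs n).2⟩, mem_univ x⟩ :
        (s n, x) ∈ Ico 0 T ×ˢ univ))
  have hge := pow_three_lt_integral_of_ofReal_lt_eLpNorm hslice hγ.le x₀ _ hc
  linarith

end Summit.NavierStokesRegularity.NavierStokesRegularity.Theorems.StrainDoors

end
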